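import Summits.BirchSwinnertonDyer.BirchSwinnertonDyer.Theorems.ClassRecordThreeCornerAtThreeBranches
import Summits.BirchSwinnertonDyer.BirchSwinnertonDyer.Theorems.ClassRecordThreeCornerAtThreeUpperHybridPos
import Summits.BirchSwinnertonDyer.BirchSwinnertonDyer.Theses.KolyvaginRoadThree

/-!
# BC3 skeleton (LINE, pre-registration form) — crux 7 `CornerAtThree` (item stmt-BirchSwinnertonDyer-19111; K2@3 `ClassRecordThree`
# rank 7, shared BY STATEMENT with `KolyvaginRoadThree`) — line `Lines/hybrid.lean` (width-lever second lane `bsd-stepL-corner3-p2` g2)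

= the REGISTERED skeleton `Lines/birth.lean` (12ed36782b0e; corner-p1 g7 ∕ planner g31) VERBATIM except that the registered stub
`stub_cornerUpper3 : Theorems.CornerAtThreeUpper` is DERIVED (no `sorry` of its own) from THREE stubs by this lane's kernel cut
`X11b.Three.cornerAtThreeUpper_of_jetchevMaxMonoPos_of_coStepLMulti_of_facts` (`Theorems/ClassRecordThreeCornerAtThreeUpperHybridPos.lean`,
p542170; file 1 p538853):
* `stub_upper3_jetchevMaxMono` — lane A's `stub_upper3_jetchevMax` (Jetchev 2008 Thm. 1.4 MAX form at 3 ∥ N on corner frames, every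
  carrier incl. `v = 3`; CLASSICAL Kolyvagin-system depth; kernel road = corner-p1's swap + walk, shared with 19947 ∕ 19109) RESTRICTED
  to MONO-carrier corner curves with `3 ∣ ∏c` (`∃ v, ord₃ ∏c ≤ ord₃ c_v`; census N < 5·10⁵: 138 of the 208 Upper pairs);
* `stub_upper3_coStepLMulti` — lane B's `Three.CornerCoStepLAt` (the Kolyvagin-system «⊇» half of the anticyclotomic BDP main conjecture at
  𝟙 on the corner frames; p530129; IMC-grade; TIGHT: ⟺ the conjunct mod cited facts) RESTRICTED to MULTI-carrier corner curves
  (`∀ v, ord₃ c_v < ord₃ ∏c`; 70 of 208) — WEAKER than lane A's `stub_upper3_jetchevMulti` on the same population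
  (`cornerCoStepLAt_of_jetchevDivisibilityAt_of_facts`);
* `stub_upper3_hybridFacts` — the eight cited facts of both roads BY NAME (never «proved» here).
Birth's `stub_cornerUpper3` becomes the DERIVED theorem `cornerUpper3_of_hybridStubs` (no `stub_` prefix, no sorry).
Other stubs (`stub_cornerStepL3`, `stub_cornerTwistLower3`, `stub_cornerTwistMuAn3`, `stub_cornerFacts3`) and both compositions
(`CornerAtThree_of` ⊢ the K2@3 decl, `CornerAtThreeKoly_of` ⊢ the KOLY decl, via `Theorems.cornerAtThree_of_branchesAn` p489722) are
birth VERBATIM. Stubs 7 ≤ stubs_max. Sorries only in `stub_*`. Nothing is asserted about any curve (T7). Published as a LINE (evidence);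
registering it (`skeleton check`) is the planner's ∕ a lead's call.
-/

set_option linter.dupNamespace false
set_option autoImplicit false

namespace Summit.BirchSwinnertonDyer.BirchSwinnertonDyer.Cruxes.CornerAtThree.Hybrid

open scoped NumberField
open WeierstrassCurve IsDedekindDomain Literature.NumberTheory.EllipticCurves
  Literature.NumberTheory.EllipticCurves.ModularForms Literature.NumberTheory.GaloisCohomology
  Literature.NumberTheory.EllipticCurves.Rank1Residual Summit.BirchSwinnertonDyer.Rank1Residual
  Summit.BirchSwinnertonDyer.Rank1Residual.X11b Summit.BirchSwinnertonDyer.Rank1Residual.X11b.Three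

/-- **stub StepL** — conjunct 1 on the corner: `∀ W, Three.CornerStepLAt W` (S0-currency STEP L at 3; kit: oriented halves). -/
theorem stub_cornerStepL3 : Summit.BirchSwinnertonDyer.BirchSwinnertonDyer.Theorems.CornerAtThreeStepL := by
  sorry

/-- **stub (Jetchev MAX form at 3 on MONO-carrier corner curves with `3 ∣ ∏c`)** — lane A's `stub_upper3_jetchevMax`
restricted to `3 ∣ ∏c ∧ ∃ v, ord₃ ∏c ≤ ord₃ c_v`: `P_n ∈ 3^s E(K[n])` for all `s ≤ ord₃ c_v(E/ℚ)` at Kolyvagin levels of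
index `≥ s`. [shape: Jetchev2008 Thm. 1.4, printed for p ∤ N, ρ̄ onto] OPEN (classical; kernel road = lane A's swap + walk). -/
theorem stub_upper3_jetchevMaxMono :
    ∀ (W : WeierstrassCurve ℚ) [W.IsElliptic] [W.IsGloballyMinimal] [NeZero (W.conductorNorm ℤ)]
      (K : Type) [Field K] [NumberField K]
      (Dt : ModularParametrizationData W (W.conductorNorm ℤ)) (β : ℤ) (ι : K →+* ℂ),
      3 ∣ W.tamagawaProduct →
      (∃ v : HeightOneSpectrum (𝓞 ℚ),
        padicValNat 3 W.tamagawaProduct ≤ padicValNat 3 (W.tamagawaNumberAt v)) →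
      ClassX11b W 3 → ¬ Surj W 3 →
      IsImaginaryQuadratic K → SatisfiesHeegnerHypothesis (W.conductorNorm ℤ) K →
      Odd (NumberField.discr K) →
      (4 * (W.conductorNorm ℤ : ℤ)) ∣ β ^ 2 - NumberField.discr K → ¬ (3 : ℤ) ∣ Dt.c →
      ∀ (v : HeightOneSpectrum (𝓞 ℚ)) (s : ℕ), s ≤ padicValNat 3 (W.tamagawaNumberAt v) →
        ∀ (n : ℕ) (d : KolyvaginHeegnerData Dt β ι n), Squarefree n →
          (∀ ℓ ∈ n.primeFactors, Zhang2014.IsKolyvaginPrime (W.conductorNorm ℤ) W K 3 ℓ ∧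
            s ≤ Zhang2014.kolyvaginIndex W 3 ℓ) → Koly.PDiv d 3 s := by
  sorry

/-- **stub (the «⊇» half at 𝟙 on MULTI-carrier corner curves)** — lane B's `Three.CornerCoStepLAt W` restricted to
`∀ v, ord₃ c_v < ord₃ ∏c`. OPEN (IMC-grade; Howard 2004 Thm. B ∕ BCK21 ∕ BCS24 need (sur) or exclude dihedral primes and
`p = 3`; TIGHT: ⟺ `Three.CornerUpperAt W` modulo cited facts). -/
theorem stub_upper3_coStepLMulti :
    ∀ (W : WeierstrassCurve ℚ) [W.IsElliptic] [W.IsGloballyMinimal],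
      (∀ v : HeightOneSpectrum (𝓞 ℚ),
        padicValNat 3 (W.tamagawaNumberAt v) < padicValNat 3 W.tamagawaProduct) →
      CornerCoStepLAt W := by
  sorry

/-- **stub (cited facts, by name)** — lane A's four (Kolyvagin; Shimura reciprocity at conductor 1; Darmon 2004 Thm. 3.6;
Cha 2005 Rmk. 25 structure fact) and lane B's four (GZK; newforms; Poitou–Tate for Selmer structures and for `Ш`). All are
`def … : Prop` facts of Literature taken BY NAME; never «proved» here. -/
theorem stub_upper3_hybridFacts :
    (∀ (N : ℕ) [NeZero N] (W : WeierstrassCurve ℚ) (K : Type) [Field K] [NumberField K], kolyvagin N W K) ∧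
    (∀ (N : ℕ) [NeZero N] (W : WeierstrassCurve ℚ) (K : Type) [Field K] [NumberField K],
      heegnerPointOfConductor_one_galoisConj N W K) ∧
    (∀ (N : ℕ) [NeZero N] (W : WeierstrassCurve ℚ) (K : Type) [Field K] [NumberField K],
      phi_heegnerTau_mem_singularModuliField N W K) ∧
    Cha2005.rmk25_padicValNat_card_sha_primary_add_le_of_globalDivisibility ∧
    rank_eq_analyticRank_of_analyticRank_le_one ∧ exists_isNewformOf ∧
    (∀ (K : Type) [Field K] [NumberField K], poitouTate_selmerStructure_duality K) ∧
    (∀ (K : Type) [Field K] [NumberField K], poitouTate_sha_tateDual K) := by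
  sorry

/-- **Conjunct 3 (birth's `stub_cornerUpper3`) — DERIVED, not a stub of this line**: from the three hybrid stubs by
`cornerAtThreeUpper_of_jetchevMaxMonoPos_of_coStepLMulti_of_facts` (p542170). No `sorry` of its own. -/
theorem cornerUpper3_of_hybridStubs : Summit.BirchSwinnertonDyer.BirchSwinnertonDyer.Theorems.CornerAtThreeUpper :=
  haveI : Fact (Nat.Prime 3) := ⟨Nat.prime_three⟩
  have hF := stub_upper3_hybridFacts
  cornerAtThreeUpper_of_jetchevMaxMonoPos_of_coStepLMulti_of_facts hF.1 hF.2.1 hF.2.2.1 hF.2.2.2.1 hF.2.2.2.2.1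
    hF.2.2.2.2.2.1 hF.2.2.2.2.2.2.1 hF.2.2.2.2.2.2.2 stub_upper3_jetchevMaxMono stub_upper3_coStepLMulti

/-- **stub TwistLower** — the 3-part lower bound at every odd Heegner twin (kit: by sign; Skinner 2016 void — no (ram)). -/
theorem stub_cornerTwistLower3 : Summit.BirchSwinnertonDyer.BirchSwinnertonDyer.Theorems.CornerAtThreeTwistLower := by
  sorry

/-- **stub TwistMuAn** — analytic μ = 0 at 3 at every odd Heegner twin (kit v2: non-split unit-value CLOSED p499490, non-unit, split). -/
theorem stub_cornerTwistMuAn3 : Summit.BirchSwinnertonDyer.BirchSwinnertonDyer.Theorems.CornerAtThreeTwistMuAn := by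
  sorry

/-- **stub Facts** — the bundle `KatoTwinFactsThreeAn`: thirteen NAMED print facts (Stein–Wuthrich Thm 6.1 ×2, GZK, entire L,
parametrisation supply, Greenberg–Stevens, Kato nonempty_iwasawaH1Data ∕ Thm 12.4 ∕ §17.13 inputs non-split ∕ split, Greenberg 1999
Thm 1.5 (mult, rational), Wuthrich 2014 Cor 18, Kato §17.13 fine). Facts are hypotheses by name; this stub is never «proved». -/
theorem stub_cornerFacts3 : (Literature.NumberTheory.EllipticCurves.SteinWuthrich2013.thm61_splitMultiplicative ∧ Literature.NumberTheory.EllipticCurves.SteinWuthrich2013.thm61_nonsplitMultiplicative ∧ Literature.NumberTheory.EllipticCurves.rank_eq_analyticRank_of_analyticRank_le_one ∧ WeierstrassCurve.hasEntireLFunction_rat ∧ Literature.NumberTheory.EllipticCurves.ModularForms.nonempty_modularParametrizationData ∧ (∀ (W : WeierstrassCurve ℚ) [W.IsElliptic] [W.IsGloballyMinimal] (p : ℕ) [Fact p.Prime], Literature.NumberTheory.EllipticCurves.greenberg_stevens W p) ∧ Literature.NumberTheory.EllipticCurves.Kato2004.nonempty_iwasawaH1Data ∧ Literature.NumberTheory.EllipticCurves.Kato2004.thm12_4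 ∧ Literature.NumberTheory.EllipticCurves.Kato2004.exists_multDivisibilityInputs_nonsplit ∧ Literature.NumberTheory.EllipticCurves.Kato2004.exists_multDivisibilityInputs_split ∧ Literature.NumberTheory.EllipticCurves.Greenberg1999.thm15_isTorsion_multiplicative_rat ∧ Literature.NumberTheory.EllipticCurves.Wuthrich2014.corollary18_padicLFunction_mem_iwasawaAlgebra_multiplicative ∧ Literature.NumberTheory.EllipticCurves.Kato2004.exists_multDivisibilityInputs_fine) := by
  sorry

/-! ## Stub statements by name -/

namespace Statement

/-- Statement of `stub_cornerStepL3`. -/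
abbrev stub_cornerStepL3 : Prop := type_of% @Hybrid.stub_cornerStepL3
/-- Statement of `stub_upper3_jetchevMaxMono`. -/
abbrev stub_upper3_jetchevMaxMono : Prop := type_of% @Hybrid.stub_upper3_jetchevMaxMono
/-- Statement of `stub_upper3_coStepLMulti`. -/
abbrev stub_upper3_coStepLMulti : Prop := type_of% @Hybrid.stub_upper3_coStepLMulti
/-- Statement of `stub_upper3_hybridFacts`. -/
abbrev stub_upper3_hybridFacts : Prop := type_of% @Hybrid.stub_upper3_hybridFacts
/-- Statement of birth's `stub_cornerUpper3` (here DERIVED: `cornerUpper3_of_hybridStubs`). -/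
abbrev stub_cornerUpper3 : Prop := type_of% @Hybrid.cornerUpper3_of_hybridStubs
/-- Statement of `stub_cornerTwistLower3`. -/
abbrev stub_cornerTwistLower3 : Prop := type_of% @Hybrid.stub_cornerTwistLower3
/-- Statement of `stub_cornerTwistMuAn3`. -/
abbrev stub_cornerTwistMuAn3 : Prop := type_of% @Hybrid.stub_cornerTwistMuAn3
/-- Statement of `stub_cornerFacts3`. -/
abbrev stub_cornerFacts3 : Prop := type_of% @Hybrid.stub_cornerFacts3

end Statement

/-! ## The composition (sorry-free): the five stub STATEMENTS imply the crux, BY NAME, on BOTH routes -/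

/-- **`CornerAtThree_of`** — corner-p1 g6's glue `Theorems.cornerAtThree_of_branchesAn` (p489722) ⊢ the K2@3 ROUTE decl. -/
theorem CornerAtThree_of (hS : Statement.stub_cornerStepL3) (hU : Statement.stub_cornerUpper3)
    (hL : Statement.stub_cornerTwistLower3) (hμ : Statement.stub_cornerTwistMuAn3) (hF : Statement.stub_cornerFacts3) :
    Summit.BirchSwinnertonDyer.BirchSwinnertonDyer.Theses.ClassRecordThree.CornerAtThree :=
  Summit.BirchSwinnertonDyer.BirchSwinnertonDyer.Theorems.cornerAtThree_of_branchesAn hS hU hL hμ hF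

/-- **`CornerAtThreeKoly_of`** — the same term ⊢ the KOLY route's by-statement copy of the crux. -/
theorem CornerAtThreeKoly_of (hS : Statement.stub_cornerStepL3) (hU : Statement.stub_cornerUpper3)
    (hL : Statement.stub_cornerTwistLower3) (hμ : Statement.stub_cornerTwistMuAn3) (hF : Statement.stub_cornerFacts3) :
    Summit.BirchSwinnertonDyer.BirchSwinnertonDyer.Theses.KolyvaginRoadThree.CornerAtThree :=
  Summit.BirchSwinnertonDyer.BirchSwinnertonDyer.Theorems.cornerAtThree_of_branchesAn hS hU hL hμ hF

/-- The crux along this line (K2@3), MODULO exactly the five stubs (sorries only in `stub_*`). -/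
theorem CornerAtThree_proof : Summit.BirchSwinnertonDyer.BirchSwinnertonDyer.Theses.ClassRecordThree.CornerAtThree :=
  CornerAtThree_of stub_cornerStepL3 cornerUpper3_of_hybridStubs stub_cornerTwistLower3 stub_cornerTwistMuAn3 stub_cornerFacts3

/-- The crux along this line (KOLY), MODULO exactly the five stubs. -/
theorem CornerAtThreeKoly_proof : Summit.BirchSwinnertonDyer.BirchSwinnertonDyer.Theses.KolyvaginRoadThree.CornerAtThree :=
  CornerAtThreeKoly_of stub_cornerStepL3 cornerUpper3_of_hybridStubs stub_cornerTwistLower3 stub_cornerTwistMuAn3 stub_cornerFacts3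

end Summit.BirchSwinnertonDyer.BirchSwinnertonDyer.Cruxes.CornerAtThree.Hybrid
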